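import Summits.QuantumFields.BalabanUV.Beta.D1BFx.RestKernelSandwichSlot

/-!
# `BalabanUV.Beta.D1BFx.RestKernelSandwichScaled` — road «BF-x», row D1, slot (K): **PART 24 (R-T) «THE SANDWICH TADPOLE MEMBER WITH HONEST UNITS» — the
# sandwich lane's rows over PER-SCALE jet letters, the rest leg's `n⁻²` KEPT, and the n-FREE row of the tadpole member from a pair-table mass letter
# that DISPLAYS its unit `n²`** (OWNER `PART24-SPEC-g23.md` c08ae833fffd2503 §1–§2 (R-T); `FINDING-F-g22-2-CURRENCY.md` v1.1 §2; `UNIT-PAGE-g23.md` §2–§3).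

WHY.  The supplier of record `RestKernelSandwichSlot.exists_rows_RkSand` (leaf-01 g23) reads the four sandwich cross words of slot (K) against k-FREE jet
letters `mV`, `mW` and DROPS the rest leg's `n⁻²` (`K∕(2n²) ≤ K∕2`, :248).  At the literal's RAW pin the tt letters are not k-free (E-g22-1 ∕ leaf-01 N-1:
the cubic table carries `cE = n⁴`, the quartic `≍ n⁸`), so those rows are EMPTY there.  This file re-reads the SAME words (`RestKernelSandwichUnit.
exists_decay510_crossWord_road`, which keeps the `n⁻²` once per `B`-letter) against PER-SCALE letters `mV m`, `mW m : ℕ → ℝ` (scale `n = m + 1`) and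
displays the resulting per-scale constants with every n-power in place (§1); then (§2) for the TADPOLE member `u = inl ()` — the word `½·tadpole B (W μ 0 ν z)`
with `B = −½(sandP)_tt`, `sup |B| ≤ K∕(2n²)` — a pair-table mass letter DISPLAYING ITS UNIT, `Σ' |W_tt(μ,0;ν,z)| ≤ n²·m̄W·e^{−κ|z|₁}` (k-free `m̄W`), gives the
n-FREE (1.22) row `|secondMoment (RkSand … (inl ()) n) μ ν| ≤ ½·(K∕2·m̄W)·Σ'_x |x|₁² e^{−κ|x|₁}`: the `n²` of the packed pair vertex is EXACTLY paid by the rest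
leg's `n⁻²` — no derivative gain needed (spec §1, member (T)).  §3 states it in the (K1) END's shapes at `n = Lc^m` (`hMR`, READING (b) `hRu` with `Ru := 0`).
The bubble members are displayed in §1 with their residual powers (`(K∕2∕n²)·(K∕2∕n²)·(mV m)²`, `(kG∕2)·(K∕2∕n²)·(mV m)²`): under a first-jet letter `mV m ≤ n^p·m̄V`
they are n-free iff `p ≤ 2` resp. `p ≤ 1` — NOT the case at the raw pin (`p = 3` under the unit page's U1 count), which is why the bubble members wait for the
derivative-gain read-outs (R-BB ∕ R-AB of the spec).  Whether the pair letter holds WITH POWER 2 and k-free `m̄W` at the road's pin is the SUPPLIER's letter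
(gan24-leaf-05 PAIR-FACE-PACK ∕ leaf-01 pair rows with the unit displayed + the colH-gradient letter L-h) — a HYPOTHESIS here, as every jet letter of the
lane; CAVEAT OF RECORD (Engine C D-g22-1 stage 1, A-g23-1 (b), RELAY 236): `n⁵·max_u |colH|` is n-flat for the STRAIGHT column (2.15, 2.42 at n = 3, 5) but grows
like `n` for the bm-DRESSED column `G₀^{bm}(ctrOff)` (4.47, 8.21 — face sheets of amplitude `≍ n⁻⁴` from the block-mean axial window), so at the bm pin the packed
pair tt mass plausibly carries `(m+1)³`, not `(m+1)²`, and §2's row would then be as EMPTY there as PART 23-hyb's `hSm` (OWNER note F-g23-1) — the theorem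
displays the power it needs; it asserts nothing about the pin.

HONEST DEPENDENCY (cell records, verbatim): «continuum YM on T⁴ ⇐ BetaPertH ∧ nine spine estimates (0/9 proved); BetaPertH ⇐ (D1) ∧ (D4) ∧
CAP+tail; G-an2-4 gates asym, D1 and NE2/3/4.»  HONEST FRAMING (cell contract, verbatim): «discharging `BetaPertH` makes Bałaban's UV stability
UNCONDITIONAL — a real constructive-QFT result; it is NOT the continuum limit and NOT the Clay problem.»  THIS MODULE DISCHARGES NOTHING of the
wall: [folklore] (1.22) read-out bookkeeping (`absMoment₂_of_decay510`, `secondMoment_abs_le_of_decay510`) of leaf-01's «RK-SAND GENERIC-IN-JETS» BY NAME, modulo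
the displayed [B5] hypotheses `h12` ∕ `h126` (the legs) and DISPLAYED per-scale jet letters.  No definition, no `def … : Prop`, nothing cited, 0 sorry.  0∕4 row-D1
binders (hW ∕ hR ∕ D1Tel ∕ D1Rep); (K) NOT closed (one tt member's row made instantiable-in-shape; the bubbles open); NOT D1, NEVER «G-an2-4 closed», NOT `BetaPertH`,
NOT continuum, NOT Clay.

ABSOLUTE RULE (cell charter, verbatim): «No internally-minted statement may enter as a cited fact. Every hypothesis is either kernel-proved in this
package or a verbatim quotation of a PUBLISHED theorem with page reference. The manuscript(s) under audit are NOT citable for their own disputed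
steps — they are the thing under adjudication; programme-internal (2001/route/tribunal) claims are never citable.»

Unit `b2b-balaban-beta-d1-p2` (road owner, gen 23), 2026-08-23; over leaf-01 g23's `RestKernelSandwichUnit` ∕ `RestKernelSandwichSlot` BY NAME; no existing file touched.
-/

noncomputable section

open Finset
open scoped BigOperators
open Literature.MathematicalPhysics.QuantumFieldTheory.Balaban1983to89
open Literature.MathematicalPhysics.QuantumFieldTheory.Balaban1983to89.Beta
open B12Sec2to5 (l1 l1_nonneg Decay510 secondMoment_abs_le_of_decay510)
open DecimatedMomentSummable (AbsMoment₂ absMoment₂_of_decay510)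
open ExpKernelCalculus (Site MKer Decays decay510_mono_const)
open KernelWard (Bdd bdd_of_decays)
open OneStepResolventKernel (Fib)
open VectorTailsLoc (fam kfam)
open Summit.QuantumFields.BalabanUV.Beta.TameKernelCalculus (decays_of_le)
open Summit.QuantumFields.BalabanUV.Beta.D1BFx.PackedKernelSplit (blk ffV ffW)
open Summit.QuantumFields.BalabanUV.Beta.D1BFx.CoarseGramInverse (multM)
open Summit.QuantumFields.BalabanUV.Beta.D1BFx.RWeightedLegPack (sandP)
open Summit.QuantumFields.BalabanUV.Beta.D1BFx.GluonLeg (Ga)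
open Summit.QuantumFields.BalabanUV.Beta.D1BFx.FrozenLegTails (nOf MOf hn1)
open Summit.QuantumFields.BalabanUV.Beta.D1BFx.RestKernelWords (crossWord)
open Summit.QuantumFields.BalabanUV.Beta.D1BFx.RestKernelSandwichUnit (exists_road_legs exists_decay510_crossWord_road decay510_crossWord_inl)
open Summit.QuantumFields.BalabanUV.Beta.D1BFx.RestKernelSandwichSlot (RkSand RkSand_succ mass_mono)

namespace Summit.QuantumFields.BalabanUV.Beta.D1BFx.RestKernelSandwichScaled

section Rows

variable {a : ℝ} (ha : 0 < a) {𝒱 : ℕ → Fin 4 → Site 4 → MKer 4 (Fib 3)} {𝒲 : ℕ → Fin 4 → Site 4 → Fin 4 → Site 4 → MKer 4 (Fib 3)}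
  {σV κ : ℝ} {μ ν : Fin 4}
include ha

/-! ## §1 The sandwich rows over PER-SCALE jet letters, every n-power displayed -/

/-- [folklore] **THE SANDWICH ROWS OVER PER-SCALE LETTERS, THE REST LEG's `n⁻²` KEPT** (mod [B5, Prop. 1.2] ∧ [B5, (1.126)–(1.127)] BY NAME; jet letters displayed:
`σV > 0`, the scale-`(m+1)` first jets' `σV∕(m+1)`-weighted centred masses `≤ mV m`; `κ > 0`, the scale-`(m+1)` second table's plain mass at `(μ, 0; ν, z)` `≤ mW m·e^{−κ|z|₁}`):
ONE n-free triple `kG, K ≥ 0`, `c > 0` such that at every scale `n = m + 1` every member has an absolutely summable (1.22) moment and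
tadpole: `|secondMoment (RkSand … (inl ()) (m+1)) μ ν| ≤ ½·((K∕2∕(m+1)²)·mW m)·Σ'_x |x|₁² e^{−κ|x|₁}`;
bubbles: `|secondMoment (RkSand … (inr (x, y)) (m+1)) μ ν| ≤ ½·(L_x·L_y·(mV m)²)·Σ'_x |x|₁² e^{−(min c σV)|x|₁}`, `L_true = K∕2∕(m+1)²`, `L_false = kG∕2`. -/
theorem exists_rows_RkSand_scaled (h12 : B5.Prop12Printed (fam nOf hn1 MOf a ha)) (h126 : B5.Kernel126_127Printed (kfam nOf MOf))
    (hσV : 0 < σV) {mV mW : ℕ → ℝ}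
    (hVs : ∀ (m : ℕ) (ρ : Fin 4) (y : Site 4), Summable fun p : Site 4 × Site 4 => ∑ g, ∑ f, |ffV (𝒱 (m + 1)) ρ y p.1 p.2 g f|
      * Real.exp (σV / ((m + 1 : ℕ) : ℝ) * (l1 (p.1 - ((m + 1 : ℕ) : ℤ) • y) + l1 (p.2 - ((m + 1 : ℕ) : ℤ) • y))))
    (hVm : ∀ (m : ℕ) (ρ : Fin 4) (y : Site 4), ∑' p : Site 4 × Site 4, ∑ g, ∑ f, |ffV (𝒱 (m + 1)) ρ y p.1 p.2 g f|
      * Real.exp (σV / ((m + 1 : ℕ) : ℝ) * (l1 (p.1 - ((m + 1 : ℕ) : ℤ) • y) + l1 (p.2 - ((m + 1 : ℕ) : ℤ) • y))) ≤ mV m)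
    (hκ : 0 < κ)
    (hWs : ∀ (m : ℕ) (z : Site 4), Summable fun p : Site 4 × Site 4 => ∑ g, ∑ f, |ffW (𝒲 (m + 1)) μ 0 ν z p.1 p.2 g f|)
    (hWm : ∀ (m : ℕ) (z : Site 4), ∑' p : Site 4 × Site 4, ∑ g, ∑ f, |ffW (𝒲 (m + 1)) μ 0 ν z p.1 p.2 g f| ≤ mW m * Real.exp (-κ * l1 z)) :
    ∃ kG K c : ℝ, 0 < c ∧ 0 ≤ kG ∧ 0 ≤ K ∧ ∀ m : ℕ,
      (∀ u : Unit, AbsMoment₂ (RkSand a 𝒱 𝒲 (Sum.inl u) (m + 1) μ ν) ∧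
        |B12Beta.secondMoment (RkSand a 𝒱 𝒲 (Sum.inl u) (m + 1)) μ ν|
          ≤ (1 / 2) * (K / 2 / (((m + 1 : ℕ) : ℝ)) ^ 2 * mW m) * ∑' x : Site 4, l1 x ^ 2 * Real.exp (-κ * l1 x)) ∧
      (∀ x y : Bool, AbsMoment₂ (RkSand a 𝒱 𝒲 (Sum.inr (x, y)) (m + 1) μ ν) ∧
        |B12Beta.secondMoment (RkSand a 𝒱 𝒲 (Sum.inr (x, y)) (m + 1)) μ ν|
          ≤ (1 / 2) * ((bif x then K / 2 / (((m + 1 : ℕ) : ℝ)) ^ 2 else kG / 2) * (bif y then K / 2 / (((m + 1 : ℕ) : ℝ)) ^ 2 else kG / 2) * mV m * mV m)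
            * ∑' w : Site 4, l1 w ^ 2 * Real.exp (-(min c σV) * l1 w)) := by
  obtain ⟨kG, K, c, hc, hkG, hK, hroad⟩ := exists_decay510_crossWord_road ha h12 h126
  refine ⟨kG, K, c, hc, hkG, hK, fun m => ?_⟩
  have hn0 : (0 : ℝ) < ((m + 1 : ℕ) : ℝ) := by exact_mod_cast Nat.succ_pos m
  -- the jets' rate `σ := min c σV ∕ n`
  set σ : ℝ := min c σV / ((m + 1 : ℕ) : ℝ) with hσdef
  have hmin0 : 0 < min c σV := lt_min hc hσV
  have hσ0 : 0 ≤ σ := by positivity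
  have hσc : σ ≤ c / ((m + 1 : ℕ) : ℝ) := div_le_div_of_nonneg_right (min_le_left _ _) hn0.le
  have hσV' : σ ≤ σV / ((m + 1 : ℕ) : ℝ) := div_le_div_of_nonneg_right (min_le_right _ _) hn0.le
  have hV := fun ρ y => mass_mono (V := ffV (𝒱 (m + 1)) ρ y) hσV' (hVs m ρ y)
  obtain ⟨hinl, hinr⟩ := hroad m (ffV (𝒱 (m + 1))) (ffW (𝒲 (m + 1))) σ (mV m) (mW m) κ μ ν hσ0 hσc
    (fun ρ y => (hV ρ y).1) (fun ρ y => (hV ρ y).2.trans (hVm m ρ y)) (hWs m) (hWm m)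
  have e : σ * ((m + 1 : ℕ) : ℝ) = min c σV := div_mul_cancel₀ _ hn0.ne'
  rw [e] at hinr
  refine ⟨fun u => ?_, fun x y => ?_⟩
  · have hd : Decay510 (RkSand a 𝒱 𝒲 (Sum.inl u) (m + 1) μ ν) ((1 / 2) * (K / 2 / (((m + 1 : ℕ) : ℝ)) ^ 2 * mW m)) κ := by
      rw [RkSand_succ]; exact hinl u
    exact ⟨absMoment₂_of_decay510 hκ hd, (secondMoment_abs_le_of_decay510 (P := RkSand a 𝒱 𝒲 (Sum.inl u) (m + 1)) hκ hd).2⟩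
  · have hd : Decay510 (RkSand a 𝒱 𝒲 (Sum.inr (x, y)) (m + 1) μ ν)
        ((1 / 2) * ((bif x then K / 2 / (((m + 1 : ℕ) : ℝ)) ^ 2 else kG / 2) * (bif y then K / 2 / (((m + 1 : ℕ) : ℝ)) ^ 2 else kG / 2)
          * mV m * mV m)) (min c σV) := by
      rw [RkSand_succ]; exact hinr x y
    exact ⟨absMoment₂_of_decay510 hmin0 hd, (secondMoment_abs_le_of_decay510 (P := RkSand a 𝒱 𝒲 (Sum.inr (x, y)) (m + 1)) hmin0 hd).2⟩

/-! ## §2 (R-T) The tadpole member's n-FREE row from a pair-table letter DISPLAYING its unit `n²` -/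

/-- [folklore] **(R-T) THE SANDWICH TADPOLE MEMBER CLOSES WITH HONEST UNITS** (mod [B5, Prop. 1.2] ∧ [B5, (1.126)–(1.127)] BY NAME; the first jets `𝒱` do NOT
enter).  If the scale-`(m+1)` packed second table's tt mass at `(μ, 0; ν, z)` is `≤ (m+1)²·m̄W·e^{−κ|z|₁}` with ONE k-free `m̄W` (the unit `n²` DISPLAYED — the shape of
the raw pin under the unit page's count), then there is ONE n-free `K ≥ 0` with, at EVERY scale and for the tadpole member,
`AbsMoment₂` ∧ `|secondMoment (RkSand a 𝒱 𝒲 (inl u) (m+1)) μ ν| ≤ ½·(K∕2·m̄W)·Σ'_x |x|₁² e^{−κ|x|₁}` — n-FREE: the rest leg's `sup |B| ≤ K∕(2(m+1)²)`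
(`exists_road_legs`) pays the table's `(m+1)²` exactly. -/
theorem exists_row_RkSand_tadpole_unit (h12 : B5.Prop12Printed (fam nOf hn1 MOf a ha)) (h126 : B5.Kernel126_127Printed (kfam nOf MOf))
    {mW : ℝ} (hκ : 0 < κ)
    (hWs : ∀ (m : ℕ) (z : Site 4), Summable fun p : Site 4 × Site 4 => ∑ g, ∑ f, |ffW (𝒲 (m + 1)) μ 0 ν z p.1 p.2 g f|)
    (hWm : ∀ (m : ℕ) (z : Site 4), ∑' p : Site 4 × Site 4, ∑ g, ∑ f, |ffW (𝒲 (m + 1)) μ 0 ν z p.1 p.2 g f|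
      ≤ ((m + 1 : ℕ) : ℝ) ^ 2 * mW * Real.exp (-κ * l1 z)) :
    ∃ K : ℝ, 0 ≤ K ∧ ∀ (m : ℕ) (u : Unit), AbsMoment₂ (RkSand a 𝒱 𝒲 (Sum.inl u) (m + 1) μ ν) ∧
      |B12Beta.secondMoment (RkSand a 𝒱 𝒲 (Sum.inl u) (m + 1)) μ ν| ≤ (1 / 2) * (K / 2 * mW) * ∑' x : Site 4, l1 x ^ 2 * Real.exp (-κ * l1 x) := by
  obtain ⟨kG, K, c, hc, -, hK, hlegs⟩ := exists_road_legs ha h12 h126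
  refine ⟨K, hK, fun m u => ?_⟩
  obtain ⟨-, hB⟩ := hlegs m
  have hn0 : (0 : ℝ) < ((m + 1 : ℕ) : ℝ) := by exact_mod_cast Nat.succ_pos m
  have hK2 : (0 : ℝ) ≤ K / 2 / (((m + 1 : ℕ) : ℝ)) ^ 2 := by positivity
  have hc0 : (0 : ℝ) ≤ c / ((m + 1 : ℕ) : ℝ) := by positivity
  -- the table letter with its unit folded: `mW′ := (m+1)²·m̄W`
  have hWm' : ∀ z : Site 4, ∑' p : Site 4 × Site 4, ∑ g, ∑ f, |ffW (𝒲 (m + 1)) μ 0 ν z p.1 p.2 g f|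
      ≤ (((m + 1 : ℕ) : ℝ) ^ 2 * mW) * Real.exp (-κ * l1 z) := fun z => hWm m z
  have h := decay510_crossWord_inl (A := (2 : ℝ)⁻¹ • Ga (m + 1) a) (V := ffV (𝒱 (m + 1))) (bdd_of_decays hB hc0) hK2 μ ν (hWs m) hWm' u
  -- `½·((K∕2∕n²)·(n²·m̄W)) = ½·(K∕2·m̄W)`
  have hd : Decay510 (RkSand a 𝒱 𝒲 (Sum.inl u) (m + 1) μ ν) ((1 / 2) * (K / 2 * mW)) κ := by
    rw [RkSand_succ]
    refine fun z => (h z).trans (le_of_eq ?_)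
    field_simp
  exact ⟨absMoment₂_of_decay510 hκ hd, (secondMoment_abs_le_of_decay510 (P := RkSand a 𝒱 𝒲 (Sum.inl u) (m + 1)) hκ hd).2⟩

/-! ## §3 The tadpole member's rows in the (K1) END's shapes at `n = Lc^m` -/

/-- [folklore] **(R-T) IN THE END's SHAPES** (`RoadEndBFxDictPointwiseS.hdict_of_pointwise` at the member `inl ()` of `RkSand a 𝒱 𝒲`; any `[NeZero Lc]`; mod
`h12 ∧ h126` + the unit-displaying pair-table letter): ONE n-free `K ≥ 0` with (i) `hMR`: `∀ m, 1 ≤ m → AbsMoment₂ (RkSand … (inl u) (Lc^m) μ ν)`; (ii) READING (b):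
`∀ m, 1 ≤ m → |secondMoment (RkSand … (inl u) (Lc^m)) μ ν − 0| ≤ ½·(K∕2·m̄W)·Σ'_x |x|₁² e^{−κ|x|₁}`; (iii) the n-uniform unit row at every `n ≥ 1`. -/
theorem exists_END_rows_RkSand_tadpole_unit {Lc : ℕ} [NeZero Lc] (h12 : B5.Prop12Printed (fam nOf hn1 MOf a ha))
    (h126 : B5.Kernel126_127Printed (kfam nOf MOf)) {mW : ℝ} (hκ : 0 < κ)
    (hWs : ∀ (m : ℕ) (z : Site 4), Summable fun p : Site 4 × Site 4 => ∑ g, ∑ f, |ffW (𝒲 (m + 1)) μ 0 ν z p.1 p.2 g f|)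
    (hWm : ∀ (m : ℕ) (z : Site 4), ∑' p : Site 4 × Site 4, ∑ g, ∑ f, |ffW (𝒲 (m + 1)) μ 0 ν z p.1 p.2 g f|
      ≤ ((m + 1 : ℕ) : ℝ) ^ 2 * mW * Real.exp (-κ * l1 z)) :
    ∃ K : ℝ, 0 ≤ K ∧
      (∀ (u : Unit) (m : ℕ), 1 ≤ m → AbsMoment₂ (RkSand a 𝒱 𝒲 (Sum.inl u) (Lc ^ m) μ ν)) ∧
      (∀ (u : Unit) (m : ℕ), 1 ≤ m →
        |B12Beta.secondMoment (RkSand a 𝒱 𝒲 (Sum.inl u) (Lc ^ m)) μ ν - 0| ≤ (1 / 2) * (K / 2 * mW) * ∑' x : Site 4, l1 x ^ 2 * Real.exp (-κ * l1 x)) ∧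
      (∀ (u : Unit) (n : ℕ), 1 ≤ n →
        AbsMoment₂ (RkSand a 𝒱 𝒲 (Sum.inl u) n μ ν) ∧
        |B12Beta.secondMoment (RkSand a 𝒱 𝒲 (Sum.inl u) n) μ ν| ≤ (1 / 2) * (K / 2 * mW) * ∑' x : Site 4, l1 x ^ 2 * Real.exp (-κ * l1 x)) := by
  obtain ⟨K, hK, hrows⟩ := exists_row_RkSand_tadpole_unit ha h12 h126 hκ hWs hWm
  have hsucc : ∀ (u : Unit) (n : ℕ), 1 ≤ n → AbsMoment₂ (RkSand a 𝒱 𝒲 (Sum.inl u) n μ ν) ∧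
      |B12Beta.secondMoment (RkSand a 𝒱 𝒲 (Sum.inl u) n) μ ν| ≤ (1 / 2) * (K / 2 * mW) * ∑' x : Site 4, l1 x ^ 2 * Real.exp (-κ * l1 x) := by
    intro u n hn
    obtain ⟨m, rfl⟩ : ∃ m, n = m + 1 := ⟨n - 1, (Nat.sub_add_cancel hn).symm⟩
    exact hrows m u
  have hLm : ∀ m : ℕ, 1 ≤ Lc ^ m := fun m => Nat.one_le_pow _ _ (Nat.pos_of_ne_zero (NeZero.ne Lc))
  refine ⟨K, hK, fun u m _ => (hsucc u (Lc ^ m) (hLm m)).1, fun u m _ => ?_, hsucc⟩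
  rw [sub_zero]
  exact (hsucc u (Lc ^ m) (hLm m)).2

end Rows

end Summit.QuantumFields.BalabanUV.Beta.D1BFx.RestKernelSandwichScaled

end
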